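import Summits.QuantumAdvantage.QuantumAdvantage.Theorems.CharDialTokenDialD2
import HarnessLib

/-!
# CharDial tower — the TOKEN DIAL, part J1: the FLIP DIAL — the win flip is a CELL CONSTANT per address class (§12a)

Cell `decomp-qadv`, lens 6 («barrier-complement carving»), generation 19 (REV3); supports stmt-QuantumAdvantage-27206 / 27207
(crux 32604).  Imports part D2 (multi-form cells, reader decisions `decB` / `decA`).

Dials 6–8 asked the readers of the transposed pair `(s, t = s+1)` other than cut `t` to be INERT on the rich set.  The toy census of
asymmetric sliding-window junta tables (memo NODE-g19-REV3 §1) shows LOW families whose every interior pair has `w … w+1` REACTING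
readers, all within distance `w` of the pair: there `richLoc` is exponentially thin but the set
`flipAny = {u : u_s ≠ u_t, the win bit flips under the transposition for SOME charge c ∈ {0,1,2}}` has density `0.29 … 0.50`.
This part proves the structural fact behind the ninth dial: on a multi-form cell whose pattern set `O` contains the juntas of the
readers AND the gap between each reader and cut `t`, whether `win_c` flips at `u` depends only on the cell and on the address CLASS
of cut `t` at `u` — through a charge-free FLIP TABLE `phi (T, V) r` (§12a: relative offsets `offB` from the frozen gap, liveness
`liveB` / `liveA`, indicators `indB` / `indA`, parity of the number of changed indicators).  ★ `flip_iff_phi`.  0 sorry.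
Part J turns it into the engine inequality `6·#WIN_c + #flipAny ≤ 6·2ⁿ + 8·p^{|G'|}·2^{Σ|J_g| + 2w}·(2cos(π/3p))ⁿ`.
-/

set_option autoImplicit false

namespace Summit.QuantumAdvantage.AdviceFreeQNC0.JLinPeel.TokenDial

open Finset SegMove

variable {n : ℕ}

section FlipConst

variable {p : ℕ} [hp : Fact p.Prime]

/-! ### §12a offsets, liveness and the flip table of a cell -/

/-- bits agreeing on a window give the same window weight. -/
theorem wseg_congr (u v : Fin n → Bool) (a b : ℕ) (h : ∀ i : Fin n, a ≤ i.val → i.val < b → u i = v i) :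
    wseg u a b = wseg v a b := by
  unfold wseg
  congr 1
  refine filter_congr fun i _ => ?_
  constructor
  · rintro ⟨hw, hu⟩; exact ⟨hw, by rw [← h i hw.1 hw.2]; exact hu⟩
  · rintro ⟨hw, hv⟩; exact ⟨hw, by rw [h i hw.1 hw.2]; exact hv⟩

/-- the RELATIVE OFFSET (mod 3, as a natural number) of cut `g`'s address against cut `t`'s, read off a pattern set `T`
(the gap between the two cuts frozen by the pattern): `(g − t) + w[t, g)` for `g ≥ t`, `2·((t − g) + w[g, t))` for `g < t`. -/
def offB (t : Fin n) (T : Finset (Fin n)) (g : Fin (n + 1)) : ℕ :=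
  if t.val ≤ g.val then (g.val - t.val) + wseg (patt T) t.val g.val
  else 2 * ((t.val - g.val) + wseg (patt T) g.val t.val)

/-- liveness of cut `g` BEFORE the swap when cut `t` sits at address class `r`. -/
def liveB (t : Fin n) (T : Finset (Fin n)) (r : ℕ) (g : Fin (n + 1)) : Bool := decide ((r + offB t T g) % 3 ≠ 0)

/-- liveness of cut `g` AFTER the swap: only cut `t`'s address moves (`+2` if `u_s = 1`, `+1` if `u_s = 0`, `addr_swap_at`). -/
def liveA (s t : Fin n) (T : Finset (Fin n)) (r : ℕ) (g : Fin (n + 1)) : Bool :=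
  if g = cut t then decide ((r + (if patt T s = true then 2 else 1)) % 3 ≠ 0) else liveB t T r g

/-- the live-fired indicator of reader `g` BEFORE the swap, on the cell `(T, V)`, when cut `t` sits at class `r`. -/
def indB (D : JLinData p n) (t : Fin n) (T : Finset (Fin n)) (V : Fin (n + 1) → ZMod p) (r : ℕ) (g : Fin (n + 1)) : Bool :=
  decB D T V g && liveB t T r g

/-- the live-fired indicator of reader `g` AFTER the swap. -/
def indA (D : JLinData p n) (G' : Finset (Fin (n + 1))) (s t : Fin n) (T : Finset (Fin n)) (V : Fin (n + 1) → ZMod p)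
    (r : ℕ) (g : Fin (n + 1)) : Bool :=
  decA D G' s t T V g && liveA s t T r g

/-- the FLIP TABLE of the cell `(T, V)`: does the win bit flip under the transposition when cut `t` sits at class `r`?  It is the
parity of the number of readers whose live-fired indicator changes — a CHARGE-FREE function of the cell index. -/
def phi (D : JLinData p n) (G' : Finset (Fin (n + 1))) (s t : Fin n) (T : Finset (Fin n)) (V : Fin (n + 1) → ZMod p)
    (r : ℕ) : Bool :=
  decide ((G'.filter fun g => indA D G' s t T V r g ≠ indB D t T V r g).card % 2 = 1)

/-! ### §12a' the constancy lemmas -/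

/-- **(liveness is a cell constant given the class of cut `t`).** if the pattern is frozen on a set `O` containing the gap
between `g` and `t`, cut `g` is live at charge `c` iff `liveB` says so at the class `addr c u t`. -/
theorem live_iff_liveB (c : ℕ) (O : Finset (Fin n)) (T : Finset (Fin n)) (u : Fin n → Bool)
    (hu : ∀ j ∈ O, u j = patt T j) (t : Fin n) (g : Fin (n + 1))
    (hgap : ∀ i : Fin n, min g.val t.val ≤ i.val → i.val < max g.val t.val → i ∈ O) :
    (c + g.val + walkExp u g.val) % 3 ≠ 0 ↔ liveB t T (addr c u t.val) g = true := by
  unfold liveB offB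
  rw [decide_eq_true_iff, addr_eq]
  by_cases hle : t.val ≤ g.val
  · rw [if_pos hle]
    have hw := walkExp_add_wseg u hle
    have hc : wseg u t.val g.val = wseg (patt T) t.val g.val :=
      wseg_congr u (patt T) t.val g.val fun i h1 h2 =>
        hu i (hgap i (by rw [min_eq_right hle]; exact h1) (by rw [max_eq_left hle]; exact h2))
    rw [hc] at hw
    have : (c + g.val + walkExp u g.val) % 3
        = ((c + t.val + walkExp u t.val) % 3 + (g.val - t.val + wseg (patt T) t.val g.val)) % 3 := by omega
    rw [this]
  · rw [if_neg hle]
    rw [not_le] at hle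
    have hw := walkExp_add_wseg u hle.le
    have hc : wseg u g.val t.val = wseg (patt T) g.val t.val :=
      wseg_congr u (patt T) g.val t.val fun i h1 h2 =>
        hu i (hgap i (by rw [min_eq_left hle.le]; exact h1) (by rw [max_eq_right hle.le]; exact h2))
    rw [hc] at hw
    have : (c + g.val + walkExp u g.val) % 3
        = ((c + t.val + walkExp u t.val) % 3 + 2 * (t.val - g.val + wseg (patt T) g.val t.val)) % 3 := by omega
    rw [this]

/-- **(readers before).** on a cell, the readers' live-fired indicators BEFORE the swap are the cell constants `indB`. -/
theorem readers_before (c : ℕ) (D : JLinData p n) (G' : Finset (Fin (n + 1))) (O : Finset (Fin n)) (t : Fin n)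
    (T : Finset (Fin n)) (V : Fin (n + 1) → ZMod p) (u : Fin n → Bool) (hu : u ∈ cellM O (patt T) (formsOf D G') V)
    (hJO : ∀ g ∈ G', D.J g ⊆ O)
    (hgap : ∀ g ∈ G', ∀ i : Fin n, min g.val t.val ≤ i.val → i.val < max g.val t.val → i ∈ O) :
    (G'.filter fun g => D.strat g u = true ∧ (c + g.val + walkExp u g.val) % 3 ≠ 0)
      = G'.filter fun g => indB D t T V (addr c u t.val) g = true := by
  have hpat := ((mem_cellM O (patt T) (formsOf D G') V u).1 hu).1
  refine filter_congr fun g hg => ?_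
  unfold indB
  rw [Bool.and_eq_true, strat_before D G' O T V u hu g hg (hJO g hg), live_iff_liveB c O T u hpat t g (hgap g hg)]

/-- **(readers after).** on a cell, the readers' live-fired indicators AFTER the swap are the cell constants `indA`. -/
theorem readers_after (c : ℕ) (D : JLinData p n) (G' : Finset (Fin (n + 1))) (O : Finset (Fin n)) (s t : Fin n)
    (hst : t.val = s.val + 1) (hsO : s ∈ O) (htO : t ∈ O) (T : Finset (Fin n)) (V : Fin (n + 1) → ZMod p)
    (u : Fin n → Bool) (hu : u ∈ cellM O (patt T) (formsOf D G') V) (hne : u s ≠ u t) (hJO : ∀ g ∈ G', D.J g ⊆ O)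
    (hgap : ∀ g ∈ G', ∀ i : Fin n, min g.val t.val ≤ i.val → i.val < max g.val t.val → i ∈ O) :
    (G'.filter fun g => D.strat g (segCompl u s.val (s.val + 2)) = true ∧
        (c + g.val + walkExp (segCompl u s.val (s.val + 2)) g.val) % 3 ≠ 0)
      = G'.filter fun g => indA D G' s t T V (addr c u t.val) g = true := by
  have hpat := ((mem_cellM O (patt T) (formsOf D G') V u).1 hu).1
  refine filter_congr fun g hg => ?_
  unfold indA liveA
  rw [Bool.and_eq_true, strat_after D G' O s t hst hsO htO T V u hu hne g hg (hJO g hg)]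
  by_cases hgt : g = cut t
  · rw [if_pos hgt, decide_eq_true_iff, hgt, cut_val, ← hpat s hsO,
      show (c + t.val + walkExp (segCompl u s.val (s.val + 2)) t.val) % 3 = addr c (segCompl u s.val (s.val + 2)) t.val
        from (addr_eq _ _ _).symm, hst, addr_swap_at c u s t hst hne]
  · rw [if_neg hgt]
    have hgv : g.val ≠ s.val + 1 := fun h => hgt (Fin.ext (by rw [cut_val]; omega))
    rw [walkExp_swap_of_ne u s t hst hne hgv, live_iff_liveB c O T u hpat t g (hgap g hg)]

omit hp in
/-- **(non-readers cancel).** outside a set `G' ∋ cut t` on which the strategy is swap-stable, the live-fired indicators do not move. -/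
theorem nonreaders_eq (c : ℕ) (D : JLinData p n) (G' : Finset (Fin (n + 1))) (s t : Fin n) (hst : t.val = s.val + 1)
    (htG : cut t ∈ G')
    (hS : ∀ g, g ∉ G' → ∀ u : Fin n → Bool, u s ≠ u t → D.strat g (segCompl u s.val (s.val + 2)) = D.strat g u)
    (u : Fin n → Bool) (hne : u s ≠ u t) :
    (univ.filter fun g : Fin (n + 1) => g ∉ G' ∧ (D.strat g (segCompl u s.val (s.val + 2)) = true ∧
        (c + g.val + walkExp (segCompl u s.val (s.val + 2)) g.val) % 3 ≠ 0))
      = univ.filter fun g : Fin (n + 1) => g ∉ G' ∧ (D.strat g u = true ∧ (c + g.val + walkExp u g.val) % 3 ≠ 0) := by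
  refine filter_congr fun g _ => ?_
  by_cases hg : g ∈ G'
  · simp only [hg, not_true_eq_false, false_and]
  · have hgv : g.val ≠ s.val + 1 := by
      intro h
      apply hg
      have : g = cut t := Fin.ext (by rw [cut_val]; omega)
      rw [this]; exact htG
    rw [hS g hg u hne, walkExp_swap_of_ne u s t hst hne hgv]

/-- **(splitting the fired-live count at the readers).** `flc = #(non-reader part) + #(reader part)`. -/
theorem flc_split_readers (c : ℕ) (y : Fin (n + 1) → (Fin n → Bool) → Bool) (G' : Finset (Fin (n + 1)))
    (v : Fin n → Bool) :
    flc c y v = (univ.filter fun g : Fin (n + 1) => g ∉ G' ∧ (y g v = true ∧ (c + g.val + walkExp v g.val) % 3 ≠ 0)).card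
      + (G'.filter fun g => y g v = true ∧ (c + g.val + walkExp v g.val) % 3 ≠ 0).card := by
  unfold flc
  have h := card_filter_add_card_filter_not
    (s := univ.filter fun g : Fin (n + 1) => y g v = true ∧ (c + g.val + walkExp v g.val) % 3 ≠ 0) (p := fun g => g ∈ G')
  have h1 : ((univ.filter fun g : Fin (n + 1) => y g v = true ∧ (c + g.val + walkExp v g.val) % 3 ≠ 0).filter
      fun g => g ∈ G') = G'.filter fun g => y g v = true ∧ (c + g.val + walkExp v g.val) % 3 ≠ 0 := by
    ext g; simp only [mem_filter, mem_univ, true_and]; tauto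
  have h2 : ((univ.filter fun g : Fin (n + 1) => y g v = true ∧ (c + g.val + walkExp v g.val) % 3 ≠ 0).filter
      fun g => ¬ g ∈ G')
      = univ.filter fun g : Fin (n + 1) => g ∉ G' ∧ (y g v = true ∧ (c + g.val + walkExp v g.val) % 3 ≠ 0) := by
    ext g; simp only [mem_filter, mem_univ, true_and]; tauto
  rw [h1, h2] at h
  omega

omit hp in
/-- **(parity of two indicator counts).** `#{f} + #{g} ≡ #{f ≠ g} (mod 2)`. -/
theorem card_add_card_mod_two {α : Type*} (s : Finset α) (f g : α → Bool) :
    ((s.filter fun x => f x = true).card + (s.filter fun x => g x = true).card) % 2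
      = (s.filter fun x => f x ≠ g x).card % 2 := by
  rw [card_filter, card_filter, card_filter, ← sum_add_distrib]
  have h : ∀ x ∈ s, ((if f x = true then 1 else 0) + (if g x = true then 1 else 0) : ℕ)
      = (if f x ≠ g x then 1 else 0) + 2 * (if (f x = true ∧ g x = true) then 1 else 0) := by
    intro x _
    cases f x <;> cases g x <;> simp
  rw [sum_congr rfl h, sum_add_distrib, ← mul_sum, Nat.add_mul_mod_self_left]

/-- ★ **THE FLIP IS A CELL CONSTANT PER CLASS.** on a multi-form cell `(T, V)` over a pattern set `O ∋ s, t` containing the juntas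
of the readers `G' ∋ cut t` and the gap between each reader and cut `t`, with the strategy swap-stable outside `G'` on the swap set:
at ANY charge `c`, the win bit flips at `u` under the transposition iff `phi (T, V) (addr c u t) = true`. -/
theorem flip_iff_phi (c : ℕ) (D : JLinData p n) (G' : Finset (Fin (n + 1))) (O : Finset (Fin n)) (s t : Fin n)
    (hst : t.val = s.val + 1) (hsO : s ∈ O) (htO : t ∈ O) (htG : cut t ∈ G')
    (hS : ∀ g, g ∉ G' → ∀ u : Fin n → Bool, u s ≠ u t → D.strat g (segCompl u s.val (s.val + 2)) = D.strat g u)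
    (hJO : ∀ g ∈ G', D.J g ⊆ O)
    (hgap : ∀ g ∈ G', ∀ i : Fin n, min g.val t.val ≤ i.val → i.val < max g.val t.val → i ∈ O)
    (T : Finset (Fin n)) (V : Fin (n + 1) → ZMod p) (u : Fin n → Bool) (hu : u ∈ cellM O (patt T) (formsOf D G') V)
    (hne : u s ≠ u t) :
    ringWinU c D.strat (segCompl u s.val (s.val + 2)) ≠ ringWinU c D.strat u ↔
      phi D G' s t T V (addr c u t.val) = true := by
  unfold phi
  rw [decide_eq_true_iff, ringWinU_eq_decide, ringWinU_eq_decide, Ne, decide_eq_decide,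
    flc_split_readers c D.strat G' (segCompl u s.val (s.val + 2)), flc_split_readers c D.strat G' u,
    nonreaders_eq c D G' s t hst htG hS u hne, readers_before c D G' O t T V u hu hJO hgap,
    readers_after c D G' O s t hst hsO htO T V u hu hne hJO hgap,
    ← card_add_card_mod_two G' (indA D G' s t T V (addr c u t.val)) (indB D t T V (addr c u t.val))]
  constructor
  · intro h; omega
  · intro h; omega

end FlipConst

end Summit.QuantumAdvantage.AdviceFreeQNC0.JLinPeel.TokenDial
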